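import Literature.AlgebraicGeometry.Resolution.GRingPolynomialReduction
import Literature.AlgebraicGeometry.Resolution.ExcellentRingsCompleteProofs
import Mathlib.RingTheory.Polynomial.Quotient
import HarnessLib

/-!
# Grothendieck's theorem on G-rings (Stacks 07PV), complete local case: reduction to complete
# regular local rings

Topic: `Literature/AlgebraicGeometry/Resolution`. Continues `GRingPolynomialReduction.lean`, which
reduced the named fact `Stacks07PV` (and `Stacks07QU`) to the hypothesis `hcore`: for a complete
Noetherian local ring `S` and a prime `Q` of `S[x]` over `𝔪_S`, the completion map
`S[x]_Q → (S[x]_Q)^` is regular. The Stacks Project, Tag 07PV, proof, second half: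

> "Let `R` be a Noetherian complete local ring and let `𝔮 ⊂ R[x]` be a maximal ideal lying over
> the maximal ideal of `R`. Let `𝔯 ⊂ 𝔮` be a prime ideal. We want to show that
> `R[x]_𝔮^∧ ⊗_{R[x]} κ(𝔯)` is a geometrically regular algebra over `κ(𝔯)`. Set `𝔭 = R ∩ 𝔯`.
> Then we can replace `R` by `R/𝔭` and `𝔮` and `𝔯` by their images in `R/𝔭[x]`, see Lemma
> 15.51.2. Hence we may assume that `R` is a domain and that `𝔯 ∩ R = (0)`. By Algebra, Lemma
> 10.160.11 we can find `R_0 ⊂ R` which is regular and such that `R` is finite over `R_0`.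
> Applying Lemma 15.51.3 we see that it suffices to prove `R[x]_𝔮^∧ ⊗_{R[x]} κ(𝔯)` is
> geometrically regular over `κ(𝔯)` when, in addition to the above, `R` is a regular complete
> local ring."

This file PROVES this reduction: `hcore` follows from the hypothesis `hker` — for a complete
*regular* local ring `A`, a prime `𝔯` of `A[x]` with `𝔯 ∩ A = (0)` and a prime `𝔫` of
`A[x]/𝔯` over `𝔪_A`, the generic formal fibre of `(A[x]/𝔯)_𝔫` is geometrically regular (this is
"`A[x]_𝔮^∧ ⊗_{A[x]} κ(𝔯)` is geometrically regular over `κ(𝔯)`" written through the quotient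
domain `A[x]/𝔯`, Lemma 15.51.2, in the form `HasGeomRegularGenericFormalFibre` of
`FormalFibres.lean`). The remaining kernel `hker` is the regular complete local case (Stacks
15.51.5 = 07PR for `𝔯 = 0` in characteristic `p`, 15.51.9 = 07PU for `𝔯 ≠ 0`, and the
characteristic-zero remark); it enters as a HYPOTHESIS (not vendored as a fact).

Rendering of the printed steps: Lemma 15.51.2 is `isGeometricallyRegular_formalFibre_of_quotient`
(reduction modulo `𝔯` itself, to the generic formal fibre of the domain `C = S[x]/𝔯 ⊇ S/𝔭`);
Lemma 10.160.11 (Cohen) is `Matsumura1987_29_4_iii_holds` applied to the complete local domain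
`S/𝔭`, giving `S_0 ⊆ S/𝔭` complete regular local with `S/𝔭` finite over `S_0`; Lemma 15.51.3 (1)
is `Stacks07PP_finite_generic_holds` applied to the finite injective map of domains
`C_0 = S_0[x]/𝔯_0 → C` (`𝔯_0 = 𝔯 ∩ S_0[x]`), whose input is `hker` for `(S_0, 𝔯_0)`.

## Content (namespace `Literature.AlgebraicGeometry.Resolution`), all proved

* `hasGeomRegularGenericFormalFibre_polynomial_quotient` — the generic formal fibre of
  `(S[x]/𝔯)_𝔫` for `S` complete local, `𝔫` over `𝔪_S`, from `hker`.
* `isRegularHom_completion_polynomial_complete_of_kernel` — `hcore` from `hker`.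
* `stacks07PV_of_kernel`, `stacks07QU_of_kernel` — the named facts from `hker`.

## Sources

* The Stacks Project, Tag 07PV (Proposition 15.51.10), proof; Tags 07PN (15.51.2), 07PP
  (15.51.3), 032D (10.160.11). [StacksProject]
* H. Matsumura, *Commutative Ring Theory*, CUP 1986, Thm. 29.4 (iii) (Cohen), proof of Thm. 32.3
  pp. 257–258 (the same reduction for `R` in place of `R[x]`). [Matsumura1987]
-/

noncomputable section

open IsLocalRing Polynomial

namespace Literature.AlgebraicGeometry.Resolution

universe u

/-! ## Finiteness of `C = S[x]/𝔯` over `C_0 = S_0[x]/𝔯_0` -/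

section Finite

variable {S₀ T C : Type u} [CommRing S₀] [CommRing T] [CommRing C] [Algebra S₀ T]

/-- If `T` is finite over `S₀` then `T[x]` is finite over `S₀[x]` (base change;
`T[x] = S₀[x] ⊗_{S₀} T`). [folklore] -/
theorem moduleFinite_polynomial [Module.Finite S₀ T] :
    letI := Polynomial.algebra S₀ T
    Module.Finite S₀[X] T[X] := by
  letI := Polynomial.algebra S₀ T
  exact Module.Finite.equiv (Algebra.IsPushout.equiv S₀ S₀[X] T T[X]).toLinearEquiv

end Finite

/-! ## The reduction -/

section Reduction

/- The kernel hypothesis `hker` (written out in each statement below): for a complete regular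
local ring `A`, a prime `𝔯` of `A[x]` with `𝔯 ∩ A = 0` and a prime `𝔫` of `A[x]/𝔯` over `𝔪_A`,
the generic formal fibre of `(A[x]/𝔯)_𝔫` is geometrically regular. -/

/-- **The regular case plus Stacks 07PP (1)**: let `S₀` be a complete regular local ring, `C` a
domain, `φ₀ : S₀[x] → C` a finite ring homomorphism injective on `S₀`, and `𝔫` a prime of `C`
whose preimage in `S₀` is `𝔪_{S₀}`. Then the generic formal fibre of `C_𝔫` is geometrically
regular: `C₀ = S₀[x]/ker φ₀ → C` is a finite injective map of Noetherian domains, `hker` gives the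
generic formal fibre of `C₀` at `𝔫 ∩ C₀`, and `Stacks07PP_finite_generic_holds` transfers it to
`C`. [cite: StacksProject, Tag 07PV (proof)] -/
theorem hasGeomRegularGenericFormalFibre_of_finite_polynomialMap
    (hker : ∀ (A : Type u) [CommRing A] [IsRegularLocalRing A] [IsAdicComplete (maximalIdeal A) A]
      (r : Ideal A[X]) [r.IsPrime], r.under A = ⊥ →
      ∀ (n : Ideal (A[X] ⧸ r)) [n.IsPrime],
        (n.comap (Ideal.Quotient.mk r)).under A = maximalIdeal A →
          HasGeomRegularGenericFormalFibre (A[X] ⧸ r) n)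
    {S₀ C : Type u} [CommRing S₀]
    [IsRegularLocalRing S₀] [IsAdicComplete (maximalIdeal S₀) S₀] [CommRing C] [IsDomain C]
    (φ₀ : S₀[X] →+* C) (hfin : φ₀.Finite) (hinj : ∀ a : S₀, φ₀ (Polynomial.C a) = 0 → a = 0)
    (n : Ideal C) [n.IsPrime] (hn : ∀ a : S₀, φ₀ (Polynomial.C a) ∈ n ↔ a ∈ maximalIdeal S₀) :
    HasGeomRegularGenericFormalFibre C n := by
  set r₀ : Ideal S₀[X] := RingHom.ker φ₀ with hr₀def
  haveI : r₀.IsPrime := RingHom.ker_isPrime φ₀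
  set C₀ := S₀[X] ⧸ r₀
  let ψ : C₀ →+* C := RingHom.kerLift φ₀
  have hψinj : Function.Injective ψ := RingHom.kerLift_injective φ₀
  letI : Algebra C₀ C := ψ.toAlgebra
  have hcomp : ψ.comp (Ideal.Quotient.mk r₀) = φ₀ :=
    RingHom.ext fun f => RingHom.kerLift_mk φ₀ f
  have hψfin : ψ.Finite :=
    RingHom.Finite.of_comp_finite (f := Ideal.Quotient.mk r₀) (hcomp ▸ hfin)
  haveI : Module.Finite C₀ C := hψfin
  -- `𝔯₀ ∩ S₀ = 0`
  have hr₀ : r₀.under S₀ = ⊥ := by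
    refine le_bot_iff.mp fun a ha => ?_
    rw [Ideal.under_def, Ideal.mem_comap, Polynomial.algebraMap_apply, Algebra.algebraMap_self,
      RingHom.id_apply, hr₀def, RingHom.mem_ker] at ha
    rw [hinj a ha]
    exact Ideal.zero_mem ⊥
  -- `𝔫₀ = 𝔫 ∩ C₀` lies over `𝔪_{S₀}`
  set n₀ : Ideal C₀ := n.comap ψ with hn₀
  have hn₀m : (n₀.comap (Ideal.Quotient.mk r₀)).under S₀ = maximalIdeal S₀ := by
    ext a
    rw [Ideal.under_def, Ideal.mem_comap, Ideal.mem_comap, Polynomial.algebraMap_apply,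
      Algebra.algebraMap_self, RingHom.id_apply, hn₀, Ideal.mem_comap, RingHom.kerLift_mk]
    exact hn a
  exact Stacks07PP_finite_generic_holds C₀ C hψinj inferInstance n (hker S₀ r₀ hr₀ n₀ hn₀m)

/-- **Generic formal fibres of `S[x]/𝔯` at primes over `𝔪_S`** (Stacks 07PV, proof, second
half, from the regular case `hker`): for a complete Noetherian local ring `S`, a prime `𝔯` of
`S[x]` and a prime `𝔫` of `C = S[x]/𝔯` over `𝔪_S`, the generic formal fibre of `C_𝔫` is
geometrically regular. Proof: `𝔭 = 𝔯 ∩ S`, `S/𝔭 ⊆ C` is a complete local domain; Cohen gives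
`S_0 ⊆ S/𝔭` complete regular local with `S/𝔭` finite over `S_0`; `S_0[x] → S/𝔭[x] → C` is
finite (base change, then a surjection), injective on `S_0`, and `𝔫` lies over `𝔪_{S_0}`; now
apply `hasGeomRegularGenericFormalFibre_of_finite_polynomialMap`.
[cite: StacksProject, Tag 07PV (proof)] -/
theorem hasGeomRegularGenericFormalFibre_polynomial_quotient
    (hker : ∀ (A : Type u) [CommRing A] [IsRegularLocalRing A] [IsAdicComplete (maximalIdeal A) A]
      (r : Ideal A[X]) [r.IsPrime], r.under A = ⊥ →
      ∀ (n : Ideal (A[X] ⧸ r)) [n.IsPrime],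
        (n.comap (Ideal.Quotient.mk r)).under A = maximalIdeal A →
          HasGeomRegularGenericFormalFibre (A[X] ⧸ r) n)
    {S : Type u} [CommRing S]
    [IsLocalRing S] [IsNoetherianRing S] [IsAdicComplete (maximalIdeal S) S] (r : Ideal S[X])
    [r.IsPrime] (n : Ideal (S[X] ⧸ r)) [n.IsPrime]
    (hn : (n.comap (Ideal.Quotient.mk r)).under S = maximalIdeal S) :
    HasGeomRegularGenericFormalFibre (S[X] ⧸ r) n := by
  classical
  -- `𝔭 = 𝔯 ∩ S`, `S̄ = S/𝔭`, `ι : S̄ → C = S[x]/𝔯` injective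
  set p : Ideal S := r.under S with hp
  haveI : p.IsPrime := Ideal.IsPrime.under S r
  haveI : IsLocalRing (S ⧸ p) :=
    IsLocalRing.of_surjective' (Ideal.Quotient.mk p) Ideal.Quotient.mk_surjective
  haveI : IsAdicComplete (maximalIdeal (S ⧸ p)) (S ⧸ p) := isAdicComplete_quotient p
  have hpker : ∀ a ∈ p, ((Ideal.Quotient.mk r).comp (algebraMap S S[X])) a = 0 := fun a ha => by
    rw [RingHom.comp_apply, Ideal.Quotient.eq_zero_iff_mem]
    exact ha
  let ι : S ⧸ p →+* S[X] ⧸ r :=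
    Ideal.Quotient.lift p ((Ideal.Quotient.mk r).comp (algebraMap S S[X])) hpker
  have hι_mk : ∀ s : S, ι (Ideal.Quotient.mk p s) = Ideal.Quotient.mk r (Polynomial.C s) :=
    fun s => rfl
  have hιinj : Function.Injective ι := by
    rw [injective_iff_map_eq_zero]
    intro y hy
    obtain ⟨s, rfl⟩ := Ideal.Quotient.mk_surjective y
    rw [hι_mk, Ideal.Quotient.eq_zero_iff_mem] at hy
    exact Ideal.Quotient.eq_zero_iff_mem.mpr hy
  -- Cohen: `S₀ ⊆ S̄` complete regular local, `S̄` finite over `S₀`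
  obtain ⟨S₀, hS₀reg, hS₀c, hS₀fin⟩ := Matsumura1987_29_4_iii_holds (S ⧸ p)
  haveI := hS₀reg
  haveI := hS₀c
  haveI := hS₀fin
  -- `θ : S̄[x] → C` is surjective; `φ₀ : S₀[x] → S̄[x] → C` is finite
  let θ : (S ⧸ p)[X] →+* S[X] ⧸ r := Polynomial.eval₂RingHom ι (Ideal.Quotient.mk r X)
  have hθ_comp : θ.comp (Polynomial.mapRingHom (Ideal.Quotient.mk p)) = Ideal.Quotient.mk r := by
    refine Polynomial.ringHom_ext (fun s => ?_) ?_
    · rw [RingHom.comp_apply, Polynomial.coe_mapRingHom, Polynomial.map_C, Polynomial.coe_eval₂RingHom,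
        Polynomial.eval₂_C, hι_mk]
    · rw [RingHom.comp_apply, Polynomial.coe_mapRingHom, Polynomial.map_X, Polynomial.coe_eval₂RingHom,
        Polynomial.eval₂_X]
  have hθsurj : Function.Surjective θ := fun c => by
    obtain ⟨f, rfl⟩ := Ideal.Quotient.mk_surjective c
    exact ⟨f.map (Ideal.Quotient.mk p), RingHom.congr_fun hθ_comp f⟩
  letI : Algebra S₀[X] (S ⧸ p)[X] := Polynomial.algebra S₀ (S ⧸ p)
  let φ₀ : S₀[X] →+* S[X] ⧸ r := θ.comp (algebraMap S₀[X] (S ⧸ p)[X])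
  have hφ₀C : ∀ a : S₀, φ₀ (Polynomial.C a) = ι (a : S ⧸ p) := fun a => by
    change θ (Polynomial.mapRingHom (algebraMap S₀ (S ⧸ p)) (Polynomial.C a)) = _
    rw [Polynomial.coe_mapRingHom, Polynomial.map_C, Polynomial.coe_eval₂RingHom, Polynomial.eval₂_C]
    rfl
  have hfin : φ₀.Finite := by
    have h1 : (algebraMap S₀[X] (S ⧸ p)[X]).Finite := RingHom.finite_algebraMap.mpr moduleFinite_polynomial
    have h2 : θ.Finite := RingHom.Finite.of_surjective θ hθsurj
    exact h2.comp h1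
  have hinj : ∀ a : S₀, φ₀ (Polynomial.C a) = 0 → a = 0 := fun a ha => by
    rw [hφ₀C] at ha
    have h1 : (a : S ⧸ p) = 0 := hιinj (by rw [ha, map_zero])
    exact Subtype.val_injective h1
  -- `𝔫` lies over `𝔪_{S̄}`, hence over `𝔪_{S₀}`
  have hnS : ∀ s : S, Ideal.Quotient.mk r (Polynomial.C s) ∈ n ↔ s ∈ maximalIdeal S := fun s => by
    rw [← hn, Ideal.under_def, Ideal.mem_comap, Ideal.mem_comap, Polynomial.algebraMap_apply,
      Algebra.algebraMap_self, RingHom.id_apply]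
  have hnSb : ∀ y : S ⧸ p, ι y ∈ n ↔ y ∈ maximalIdeal (S ⧸ p) := fun y => by
    obtain ⟨s, rfl⟩ := Ideal.Quotient.mk_surjective y
    rw [hι_mk, hnS]
    haveI : IsLocalHom (Ideal.Quotient.mk p) :=
      IsLocalHom.of_surjective (Ideal.Quotient.mk p) Ideal.Quotient.mk_surjective
    constructor
    · intro hs
      rw [IsLocalRing.mem_maximalIdeal, mem_nonunits_iff]
      intro hu
      exact ((IsLocalRing.mem_maximalIdeal _).mp hs)
        ((isUnit_map_iff (Ideal.Quotient.mk p) s).mp hu)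
    · intro hy
      rw [IsLocalRing.mem_maximalIdeal, mem_nonunits_iff]
      intro hu
      exact ((IsLocalRing.mem_maximalIdeal _).mp hy) (hu.map (Ideal.Quotient.mk p))
  haveI : Algebra.IsIntegral S₀ (S ⧸ p) := Algebra.IsIntegral.of_finite S₀ (S ⧸ p)
  have hmS₀ : (maximalIdeal (S ⧸ p)).comap (algebraMap S₀ (S ⧸ p)) = maximalIdeal S₀ :=
    haveI : ((maximalIdeal (S ⧸ p)).comap (algebraMap S₀ (S ⧸ p))).IsMaximal :=
      Ideal.isMaximal_comap_of_isIntegral_of_isMaximal (R := S₀) (maximalIdeal (S ⧸ p))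
    IsLocalRing.eq_maximalIdeal ‹_›
  have hnS₀ : ∀ a : S₀, φ₀ (Polynomial.C a) ∈ n ↔ a ∈ maximalIdeal S₀ := fun a => by
    rw [hφ₀C, hnSb, ← hmS₀, Ideal.mem_comap]
    rfl
  exact hasGeomRegularGenericFormalFibre_of_finite_polynomialMap hker φ₀ hfin hinj n hnS₀

/-- **`hcore` from the regular case** (Stacks 07PV, proof, second half): for a complete Noetherian
local ring `S` and a prime `Q` of `S[x]` over `𝔪_S`, the completion map `S[x]_Q → (S[x]_Q)^` is
regular — flat, and its fibre over a prime `𝔯'` (`𝔯 = 𝔯' ∩ S[x]`) is the generic formal fibre of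
the quotient domain `(S[x]/𝔯)_{Q/𝔯}` (Lemma 15.51.2, `isGeometricallyRegular_formalFibre_of_quotient`),
geometrically regular by `hasGeomRegularGenericFormalFibre_polynomial_quotient`.
[cite: StacksProject, Tag 07PV (proof)] -/
theorem isRegularHom_completion_polynomial_complete_of_kernel
    (hker : ∀ (A : Type u) [CommRing A] [IsRegularLocalRing A] [IsAdicComplete (maximalIdeal A) A]
      (r : Ideal A[X]) [r.IsPrime], r.under A = ⊥ →
      ∀ (n : Ideal (A[X] ⧸ r)) [n.IsPrime],
        (n.comap (Ideal.Quotient.mk r)).under A = maximalIdeal A →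
          HasGeomRegularGenericFormalFibre (A[X] ⧸ r) n)
    {S : Type u} [CommRing S]
    [IsLocalRing S] [IsNoetherianRing S] [IsAdicComplete (maximalIdeal S) S] (Q : Ideal S[X])
    [Q.IsPrime] (hQ : Q.under S = maximalIdeal S) :
    IsRegularHom (Localization.AtPrime Q)
      (AdicCompletion (maximalIdeal (Localization.AtPrime Q)) (Localization.AtPrime Q)) := by
  haveI : IsNoetherianRing (Localization.AtPrime Q) :=
    IsLocalization.isNoetherianRing Q.primeCompl _ inferInstance
  refine ⟨AdicCompletion.flat_of_isNoetherian _, fun p' _ => ?_⟩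
  -- `𝔯 = 𝔯' ∩ S[x] ⊆ Q`, `C = S[x]/𝔯`, `𝔫 = Q/𝔯`
  let r : Ideal S[X] := p'.comap (algebraMap S[X] (Localization.AtPrime Q))
  have hrQ : r ≤ Q := fun a ha =>
    (IsLocalization.AtPrime.to_map_mem_maximal_iff (Localization.AtPrime Q) Q a).mp
      (IsLocalRing.le_maximalIdeal (Ideal.IsPrime.ne_top ‹p'.IsPrime›) ha)
  haveI : r.IsPrime := Ideal.comap_isPrime _ p'
  have hker' : RingHom.ker (Ideal.Quotient.mk r) ≤ Q := by rwa [Ideal.mk_ker]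
  haveI hn : (Q.map (Ideal.Quotient.mk r)).IsPrime :=
    Ideal.map_isPrime_of_surjective Ideal.Quotient.mk_surjective hker'
  have hP : Q = (Q.map (Ideal.Quotient.mk r)).comap (Ideal.Quotient.mk r) := by
    rw [Ideal.comap_map_of_surjective _ Ideal.Quotient.mk_surjective, ← RingHom.ker_eq_comap_bot,
      Ideal.mk_ker, sup_eq_left.mpr hrQ]
  refine isGeometricallyRegular_formalFibre_of_quotient Q p' r rfl (Q.map (Ideal.Quotient.mk r))
    hP ?_
  refine hasGeomRegularGenericFormalFibre_polynomial_quotient hker r (Q.map (Ideal.Quotient.mk r)) ?_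
  rw [← hP]
  exact hQ

/-- **The named fact `Stacks07PV` from the regular complete local kernel `hker`.**
[cite: StacksProject, Tag 07PV] -/
theorem stacks07PV_of_kernel
    (hker : ∀ (A : Type u) [CommRing A] [IsRegularLocalRing A] [IsAdicComplete (maximalIdeal A) A]
      (r : Ideal A[X]) [r.IsPrime], r.under A = ⊥ →
      ∀ (n : Ideal (A[X] ⧸ r)) [n.IsPrime],
        (n.comap (Ideal.Quotient.mk r)).under A = maximalIdeal A →
          HasGeomRegularGenericFormalFibre (A[X] ⧸ r) n) :
    Stacks07PV.{u} :=
  stacks07PV_of_core fun _S _ _ _ _ Q _ hQ =>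
    isRegularHom_completion_polynomial_complete_of_kernel hker Q hQ

/-- **The named fact `Stacks07QU` from the regular complete local kernel `hker`.**
[cite: StacksProject, Tag 07QU] -/
theorem stacks07QU_of_kernel
    (hker : ∀ (A : Type u) [CommRing A] [IsRegularLocalRing A] [IsAdicComplete (maximalIdeal A) A]
      (r : Ideal A[X]) [r.IsPrime], r.under A = ⊥ →
      ∀ (n : Ideal (A[X] ⧸ r)) [n.IsPrime],
        (n.comap (Ideal.Quotient.mk r)).under A = maximalIdeal A →
          HasGeomRegularGenericFormalFibre (A[X] ⧸ r) n) :
    Stacks07QU.{u} :=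
  stacks07QU_of_stacks07PV (stacks07PV_of_kernel hker)

end Reduction

end Literature.AlgebraicGeometry.Resolution

end
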